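import Summits.CriticalPhenomena.SAWScalingLimit.Theses.SAWDeterminantalDiagonal

/-!
# `AssemblyTarget` (stmt-CriticalPhenomena-8251): `Target → SAWScalingLimit` for route `SAWDeterminantalDiagonal`

Support item stmt-CriticalPhenomena-8251: pure logic.  The route's target is the conjunction (DW) ∧ (U): (DW) some fugacity
`x > 0` at which the dressed discrepancy-walk laws converge to chordal SLE_{8/3} in every Dobrushin domain, and (U) for
every `x > 0` such convergence transfers to the critical SAW laws, i.e. gives `SAWScalingLimit`.  Instantiate (U) at the
fugacity of (DW).  No mathematics; landed so that the item closes. [cite: LawlerSchrammWerner2004SAW, §4.1 Prediction 1]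
-/

namespace Summit.CriticalPhenomena.SAWScalingLimit.Theorems

open Summit.CriticalPhenomena.SAWScalingLimit.Theses

/-- **`AssemblyTarget` (stmt-CriticalPhenomena-8251)** of route `SAWDeterminantalDiagonal`: `Target → SAWScalingLimit`,
instantiating the universality clause (U) at the fugacity given by (DW). [folklore] -/
theorem DetDiagAssemblyTarget_proof : SAWDeterminantalDiagonal.AssemblyTarget := by
  intro hT
  obtain ⟨⟨x, hx, hDW⟩, hU⟩ := hT
  exact hU x hx hDW

end Summit.CriticalPhenomena.SAWScalingLimit.Theorems
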